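import Summits.Ventures.DiscreteObjects.Hadamard.Order167CirculantArray668
import Summits.Ventures.DiscreteObjects.Hadamard.Order333Exact668
import Summits.Ventures.DiscreteObjects.Hadamard.CyclicCoreDictionary668
import Summits.Ventures.DiscreteObjects.Hadamard.Order75FixedPoints668
import Summits.Ventures.DiscreteObjects.Hadamard.ItoTypeAut334
import Summits.Ventures.DiscreteObjects.Hadamard.Order334NegacyclicArray668
import Summits.Ventures.DiscreteObjects.Hadamard.Order222Structure668

/-!
# H(668): the automorphism ⇒ construction-family dictionary in one statement (packaging for STATEMENT.md, gen 19)

Framing: lottery ticket; floor = certified bounds/negative ranges.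

Cell pub-namedobj (venture DiscreteObjects), target (H), hadamard gen 19.  One quotable kernel statement collecting the gen-19
files.  For every Hadamard matrix `H` of order `668` and every signed automorphism `(π, κ, d, e)`, `N = orderOf (π, κ)`:
1. `167 ∣ N` ⇒ a Goethals–Seidel quadruple over `ZMod 167` exists (family F2) AND some H(668) is a `4 × 4` array of circulant
   blocks of order `167` (`Order167GSQuad668`, `Order167CirculantArray668`; the latter is an iff, `hadamard668_aut167_iff_circulantArray`);
2. `333 ∣ N` ⇒ `N = 333` and a Legendre pair of length `333` exists (family F3; iff, `hadamard668_aut333_iff_legendrePair333`;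
   `Order333LegendrePair668`, `Order666Excluded668`, `Order333Exact668`);
3. `N = 334` ⇒ a negaperiodic complementary pair of length `334` exists (Ito / dicyclic family F9; `Order334NegaPair668`; the
   Ito-type array conversely has such an automorphism, `ItoTypeAut334`) AND some H(668) is a `2 × 2` array of negacyclic blocks
   of order `334` (iff, `hadamard668_aut334_iff_negacyclicArray`, `Order334NegacyclicArray668`);
4. `75 ∣ N` ⇒ a power of pair order `75` fixes exactly `2 + 2` or `8 + 8` rows and columns (`Order75FixedPoints668`);
5. `666 ∤ N` (`Order666Excluded668`);
6. `N = 222` ⇒ the involution part `g¹¹¹` fixes exactly `224` rows and `224` columns (type I; `Order222Structure668`).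
Nothing new is proved here.  Dictionary / structure (items 1–4) and one exclusion (item 5) about a HYPOTHETICAL H(668); no
existence claimed.  Ours; no `sorry`.
-/

namespace Summit.Ventures.DiscreteObjects.Hadamard

open Finset BigOperators Matrix

open Literature.Combinatorics.Designs.GoethalsSeidel (IsHadamardMatrix)
open Literature.Combinatorics.Designs.LegendrePairs (PAF IsPM LegendrePair)

variable {ι : Type*} [Fintype ι] [DecidableEq ι]

/-- **H(668): automorphism orders 167 / 333 / 334 / 75 / 666 / 222 versus the construction families (summary).** -/
theorem hadamard668_aut_families_dictionary {H : Matrix ι ι ℤ} (hH : IsHadamardMatrix H) (hι : Fintype.card ι = 668)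
    (π κ : Equiv.Perm ι) (d e : ι → ℤ) (haut : IsSignedAut H π κ d e) :
    (167 ∣ orderOf ((π, κ) : Equiv.Perm ι × Equiv.Perm ι) →
      (∃ a b c d : ZMod 167 → ℤ, GSQuad a b c d) ∧
      ∃ x : Fin 4 → Fin 4 → ZMod 167 → ℤ,
        IsHadamardMatrix (Matrix.of fun (a b : Fin 4 × ZMod 167) => x a.1 b.1 (b.2 - a.2))) ∧
    (333 ∣ orderOf ((π, κ) : Equiv.Perm ι × Equiv.Perm ι) →
      orderOf ((π, κ) : Equiv.Perm ι × Equiv.Perm ι) = 333 ∧ ∃ a b : ZMod 333 → ℤ, LegendrePair a b) ∧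
    (orderOf ((π, κ) : Equiv.Perm ι × Equiv.Perm ι) = 334 →
      (∃ a b : ZMod 668 → ℤ, IsPM a ∧ IsPM b ∧ (∀ t, a (t + 334) = -a t) ∧ (∀ t, b (t + 334) = -b t) ∧
        ∀ s : ZMod 668, s ≠ 0 → s ≠ 334 → PAF a s + PAF b s = 0) ∧
      ∃ x : Fin 2 → Fin 2 → ZMod 668 → ℤ, (∀ p q r, x p q (r + 334) = -x p q r) ∧
        IsHadamardMatrix
          (Matrix.of fun (a b : Fin 2 × ZMod 334) => x a.1 b.1 ((b.2.val : ZMod 668) - (a.2.val : ZMod 668)))) ∧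
    (75 ∣ orderOf ((π, κ) : Equiv.Perm ι × Equiv.Perm ι) →
      ∃ k : ℕ, orderOf ((π ^ k, κ ^ k) : Equiv.Perm ι × Equiv.Perm ι) = 75 ∧
        (((univ.filter fun i => (π ^ k) i = i).card = 2 ∧ (univ.filter fun j => (κ ^ k) j = j).card = 2) ∨
         ((univ.filter fun i => (π ^ k) i = i).card = 8 ∧ (univ.filter fun j => (κ ^ k) j = j).card = 8))) ∧
    ¬ 666 ∣ orderOf ((π, κ) : Equiv.Perm ι × Equiv.Perm ι) ∧
    (orderOf ((π, κ) : Equiv.Perm ι × Equiv.Perm ι) = 222 →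
      (univ.filter fun i => (π ^ 111) i = i).card = 224 ∧ (univ.filter fun j => (κ ^ 111) j = j).card = 224) := by
  refine ⟨fun h => ⟨gsQuad_of_hadamard668_orderOf_dvd_167 hH hι haut h, ?_⟩, fun h => ⟨?_, ?_⟩, fun h => ⟨?_, ?_⟩,
    fun h => ?_, ?_, fun h => ?_⟩
  · -- a power of pair order 167 (universe-polymorphic form of `hadamard668_aut167_iff_circulantArray.mp`)
    set g : Equiv.Perm ι × Equiv.Perm ι := (π, κ) with hg
    have hg0 : orderOf g ≠ 0 := (orderOf_pos g).ne'
    set k := orderOf g / 167 with hk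
    have hord : orderOf (g ^ k) = 167 := orderOf_pow_orderOf_div hg0 h
    have hgk : g ^ k = ((π ^ k, κ ^ k) : Equiv.Perm ι × Equiv.Perm ι) := by rw [hg, Prod.pow_mk]
    rw [hgk] at hord
    obtain ⟨h1, h2, h3⟩ := pow_data_of_orderOf hord (a := 1) Nat.one_pos (by norm_num)
    rw [pow_one, pow_one] at h3
    obtain ⟨x, hx, -⟩ := exists_circulantArray_of_hadamard668_signedAut_167 hH hι (isSignedAut_pow haut k) h1 h2 h3
    exact ⟨x, hx⟩
  · exact hadamard668_orderOf_eq_333_of_dvd hH hι π κ d e haut h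
  · exact legendrePair_of_hadamard668_orderOf_dvd_333 hH hι haut h
  · exact negaPair_of_hadamard668_orderOf_334 hH hι π κ d e haut h
  · obtain ⟨hπ, hκ, h2⟩ := pow_data_of_orderOf h (a := 2) (by norm_num) (by norm_num)
    obtain ⟨-, -, h167⟩ := pow_data_of_orderOf h (a := 167) (by norm_num) (by norm_num)
    obtain ⟨x, -, hanti, hM, -⟩ := exists_negacyclicArray_of_hadamard668_signedAut_334 hH hι haut hπ hκ h2 h167
    exact ⟨x, hanti, hM⟩
  · exact hadamard668_orderOf_dvd_75_fixed hH hι π κ d e haut h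
  · exact hadamard668_signedAut_not_dvd_orderOf_666 hH hι π κ d e haut
  · obtain ⟨hπ, hκ, h111⟩ := pow_data_of_orderOf h (a := 111) (by norm_num) (by norm_num)
    obtain ⟨-, -, h74⟩ := pow_data_of_orderOf h (a := 74) (by norm_num) (by norm_num)
    obtain ⟨-, -, h6⟩ := pow_data_of_orderOf h (a := 6) (by norm_num) (by norm_num)
    exact hadamard668_order222_involution_typeI hH hι π κ d e haut hπ hκ h111 h74 h6

end Summit.Ventures.DiscreteObjects.Hadamard
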